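import Mathlib.Algebra.Group.Semiconj.Basic
import Literature.AlgebraicGeometry.Frobenioids.BaseCategoryTheoreticityDefs
import HarnessLib

/-!
# Frobenioids I, Proposition 3.3 (i): base-identity pre-steps and `End(C^pl-bk_A → C)^bs-iso` — PROOFS

Mochizuki, *The geometry of Frobenioids I: the general theory*, Kyushu J. Math. **62** (2008),
kurims text pp. 59–61 [cite: MochizukiFrdI2008, Prop. 3.3 (i) pp.59-61]. Proof-only companion of
`BaseCategoryTheoreticityDefs.lean` (seat abc-iut-L1-t3), which types Prop. 3.3 (i) as the two
conclusion predicates `Prop33i_forward S A`, `Prop33i_converse S A` over `S : PreFrobenioidData C D`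
(abc-iut cell node `FrdI:Prop3.3(i)`).

* `prop33i_converse_core` — the converse direction PROVED for every `S` and `A` in component form
  (the data `Γ`, `Δ_d` with `Δ_d Γ = Γ^d Δ_d`, `Δ` multiplicative and unital, `Γ_{id_A} = α`), following
  the printed argument (p. 60–61): the section `ζ : N_{≥1} → End_C(A)` of a Frobenius-trivial `A`
  and a base-identity pre-step `α ∈ O^▷(A)` satisfy `ζ_d α = α^d ζ_d` because `A` is
  Frobenius-normalized, and both lift uniquely along every pull-back morphism `B → A` to
  base-identity endomorphisms of `B` (Prop. 1.11 (iii), which "follows immediately from the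
  isomorphism of functors appearing in the definition of a pull-back morphism", p. 37 — used here in
  that definitional form); uniqueness of the lifts gives naturality and the relation.
* `StandardFrobenioid.exists_hom` — homomorphisms out of `𝔽 = ℤ_{≥0} ⋊ N_{≥1}` from an element `Θ`
  and a homomorphism `Λ : N_{≥1} → G` with `Λ_d Θ = Θ^d Λ_d` ("the structure of `𝔽`", Def. 1.1 (iii)).
* `prop33i_forward_isLinear` — the "linear" half of the forward direction, for every `S`: the
  relation `Δ_d Γ = Γ^d Δ_d` forces `deg_Fr(Γ_φ) = deg_Fr(Γ_φ)^d` in the commutative monoid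
  `N_{≥1}`, hence `deg_Fr(Γ_φ) = 1` (the printed "structure of `𝔽`" argument, p. 60).
The "base-identity" half of the forward direction (which uses that `D` is Frobenius-slim through
the equivalence `C^pl-bk_A ⥲ D_{A_D}` of Def. 1.3 (i)(c), hence the Frobenioid axioms) is proved in
`BaseIdentityPreStepsSlim.lean`; the wrappers to the statement owner's predicates `Prop33i_forward`,
`Prop33i_converse` (homomorphism form) follow their revision. No new definitions.
-/

namespace Literature.AlgebraicGeometry.Frobenioids

open CategoryTheory

universe w v v' u u'

/-! ### Homomorphisms out of the standard Frobenioid `𝔽 = ℤ_{≥0} ⋊ N_{≥1}` -/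

namespace StandardFrobenioid

/-- A homomorphism of monoids out of `𝔽` is the same as an element `Θ` (the image of `γ = (1,1)`)
and a homomorphism `Λ : N_{≥1} → G` (the images of the `(0,d)`) with `Λ_d Θ = Θ^d Λ_d`: then
`(a, n) ↦ Θ^a Λ_n` is a homomorphism (FrdI Def. 1.1 (iii), "the structure of `𝔽`", used on p. 60).
[cite: MochizukiFrdI2008, Def. 1.1 (iii) p.20] -/
theorem exists_hom {G : Type*} [Monoid G] (Θ : G) (Λ : ℕ+ →* G)
    (h : ∀ n : ℕ+, Λ n * Θ = Θ ^ (n : ℕ) * Λ n) :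
    ∃ f : StandardFrobenioid →* G, f gen = Θ ∧ ∀ n, f (degSection n) = Λ n := by
  have hsc : ∀ (n : ℕ+) (b : ℕ), Λ n * Θ ^ b = Θ ^ ((n : ℕ) * b) * Λ n := fun n b => by
    rw [pow_mul]; exact (SemiconjBy.pow_right (h n) b).eq
  refine ⟨{ toFun := fun x => Θ ^ (Multiplicative.toAdd x.div) * Λ x.degFr,
            map_one' := by simp
            map_mul' := fun x y => ?_ }, ?_, fun n => ?_⟩
  · show Θ ^ Multiplicative.toAdd (x.div * y.div ^ (x.degFr : ℕ)) * Λ (x.degFr * y.degFr) =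
      Θ ^ Multiplicative.toAdd x.div * Λ x.degFr * (Θ ^ Multiplicative.toAdd y.div * Λ y.degFr)
    rw [toAdd_mul, toAdd_pow, smul_eq_mul, pow_add, map_mul, mul_assoc, mul_assoc,
      ← mul_assoc (Λ x.degFr), hsc, mul_assoc]
  · show Θ ^ Multiplicative.toAdd (Multiplicative.ofAdd 1) * Λ 1 = Θ
    rw [toAdd_ofAdd, pow_one, map_one, mul_one]
  · show Θ ^ Multiplicative.toAdd (1 : Multiplicative ℕ) * Λ n = Λ n
    rw [toAdd_one, pow_zero, one_mul]

end StandardFrobenioid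

variable {C : Type u} [Category.{v} C] {D : Type u'} [Category.{v'} D]
variable (S : PreFrobenioidData.{w} C D)

namespace PreFrobenioidData

/-! ### Proposition 1.11 (iii) in definitional form: lifting endomorphisms along pull-back morphisms -/

/-- **Prop. 1.11 (iii)** (the case `β_D = id`), from the definition of a pull-back morphism: a
base-identity endomorphism `ε` of `A` lifts uniquely along a pull-back morphism `φ : B → A` to an
endomorphism `ψ` of `B` with `Base(ψ) = id` and `φ ∘ ψ = ε ∘ φ` (FrdI p. 36–37).
[cite: MochizukiFrdI2008, Prop. 1.11 (iii) p.36] -/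
theorem existsUnique_lift_of_isBaseIdentity {A B : C} {φ : B ⟶ A} (hφ : S.IsPullbackMorphism φ)
    (ε : A ⟶ A) (hε : S.IsBaseIdentity ε) :
    ∃! ψ : B ⟶ B, ψ ≫ φ = φ ≫ ε ∧ S.base.map ψ = 𝟙 _ :=
  hφ (φ ≫ ε) (𝟙 _) (by rw [Category.id_comp, Functor.map_comp, hε, Category.comp_id])

/-- Frobenius degrees of powers of an endomorphism: `deg_Fr(f^n) = deg_Fr(f)^n` (Remark 1.1.1).
[cite: MochizukiFrdI2008, Rem. 1.1.1 p.21] -/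
theorem degFr_pow {A : C} (f : End A) (n : ℕ) : S.degFr (f ^ n) = S.degFr f ^ n := by
  induction n with
  | zero => rw [pow_zero, pow_zero]; exact S.degFr_id A
  | succ n ih => rw [pow_succ, S.degFr_mul, ih, ← pow_succ']

/-! ### Proposition 3.3 (i), forward direction: the Frobenius-degree half -/

/-- **Prop. 3.3 (i)**, forward direction, "linear" half — for every `S`, with or without the
Frobenius-slimness of `D`: if `Δ_d Γ = Γ^d Δ_d` componentwise for all `d`, every component `Γ_φ` is
linear. (Printed argument, p. 60: the homomorphism `𝔽 → N_{≥1}` "obtained by considering the Frobenius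
degree … [in light of the fact that the monoid `N_{≥1}` is commutative, together with the structure of
`𝔽`] necessarily factors through `𝔽 ↠ N_{≥1}`".) [cite: MochizukiFrdI2008, Prop. 3.3 (i) p.60] -/
theorem prop33i_forward_isLinear (A : C) (Γ : S.EndPlbkBsIso A) (Δ : ℕ+ → S.EndPlbkBsIso A)
    (hrel : ∀ (d : ℕ+) ⦃B : C⦄ (φ : B ⟶ A) (hφ : S.IsPullbackMorphism φ),
      (Δ d).app φ hφ * Γ.app φ hφ = Γ.app φ hφ ^ (d : ℕ) * (Δ d).app φ hφ)
    ⦃B : C⦄ (φ : B ⟶ A) (hφ : S.IsPullbackMorphism φ) :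
    S.IsLinear (show B ⟶ B from Γ.app φ hφ) := by
  have h2 := congrArg S.degFr (hrel 2 φ hφ)
  rw [S.degFr_mul, S.degFr_mul, degFr_pow] at h2
  -- `a · b = b · a²` in `N_{≥1}`, hence `a = 1`
  have h2' := congrArg PNat.val h2
  simp only [PNat.mul_coe, PNat.pow_coe] at h2'
  have two : ((2 : ℕ+) : ℕ) = 2 := rfl
  rw [two] at h2'
  have ha0 : 0 < (S.degFr (Γ.app φ hφ) : ℕ) := PNat.pos _
  have hb0 : 0 < (S.degFr ((Δ 2).app φ hφ) : ℕ) := PNat.pos _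
  have h3 : (S.degFr (Γ.app φ hφ) : ℕ) * (S.degFr ((Δ 2).app φ hφ) : ℕ) =
      (S.degFr (Γ.app φ hφ) : ℕ) * (S.degFr (Γ.app φ hφ) : ℕ) * (S.degFr ((Δ 2).app φ hφ) : ℕ) := by
    rw [h2']; ring
  have h4 : (S.degFr (Γ.app φ hφ) : ℕ) * 1 = (S.degFr (Γ.app φ hφ) : ℕ) * (S.degFr (Γ.app φ hφ) : ℕ) := by
    rw [mul_one]; exact Nat.eq_of_mul_eq_mul_right hb0 h3
  exact PNat.coe_eq_one_iff.mp (Nat.eq_of_mul_eq_mul_left ha0 h4).symm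

/-! ### Proposition 3.3 (i), converse direction -/

/-- **Prop. 3.3 (i)**, converse direction [FrdI p. 59, proof pp. 60–61], in component form, for every `S`
and `A`: if `C` is of Frobenius-normalized type and `A` is Frobenius-trivial, every base-identity pre-step
endomorphism `α ∈ O^▷(A)` is the component at `id_A` of the image `Γ` of `γ = (1,1)` under a homomorphism
`𝔽 → End(C^pl-bk_A → C)^bs-iso`, presented by `Γ` and the images `Δ_d` of `(0, d)`: `Δ_d Γ = Γ^d Δ_d`,
`Δ_1 = 1`, `Δ_{de} = Δ_d Δ_e` componentwise — namely the unique base-identity lifts of `α` and of `ζ_d`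
along the pull-back morphisms `B → A`. [cite: MochizukiFrdI2008, Prop. 3.3 (i) p.59] -/
theorem prop33i_converse_core (hFN : S.IsOfFrobeniusNormalizedType) {A : C} (hFT : S.IsFrobeniusTrivial A)
    (hA : S.IsPullbackMorphism (𝟙 A)) (α : End A) (hα : α ∈ S.endSubmonoid A) :
    ∃ (Γ : S.EndPlbkBsIso A) (Δ : ℕ+ → S.EndPlbkBsIso A),
      (∀ (d : ℕ+) ⦃B : C⦄ (φ : B ⟶ A) (hφ : S.IsPullbackMorphism φ),
          (Δ d).app φ hφ * Γ.app φ hφ = Γ.app φ hφ ^ (d : ℕ) * (Δ d).app φ hφ) ∧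
        (∀ ⦃B : C⦄ (φ : B ⟶ A) (hφ : S.IsPullbackMorphism φ), (Δ 1).app φ hφ = 1) ∧
        (∀ (d e : ℕ+) ⦃B : C⦄ (φ : B ⟶ A) (hφ : S.IsPullbackMorphism φ),
          (Δ (d * e)).app φ hφ = (Δ d).app φ hφ * (Δ e).app φ hφ) ∧
        Γ.app (𝟙 A) hA = α := by
  obtain ⟨ζ, hζ⟩ := hFT
  -- unique base-identity lifts of base-identity endomorphisms of `A` along pull-back morphisms
  choose L hL hLu using fun ⦃B : C⦄ (φ : B ⟶ A) (hφ : S.IsPullbackMorphism φ) (ε : A ⟶ A)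
    (hε : S.IsBaseIdentity ε) => S.existsUnique_lift_of_isBaseIdentity hφ ε hε
  simp only at hL hLu
  -- uniqueness, restated: an endomorphism over `ε` with identity base IS the lift
  have huniq : ∀ ⦃B : C⦄ (φ : B ⟶ A) (hφ : S.IsPullbackMorphism φ) (ε : A ⟶ A)
      (hε : S.IsBaseIdentity ε) (y : B ⟶ B), y ≫ φ = φ ≫ ε → S.base.map y = 𝟙 _ → y = L φ hφ ε hε :=
    fun B φ hφ ε hε y h1 h2 => hLu φ hφ ε hε y ⟨h1, h2⟩
  -- lifts are multiplicative (composition) …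
  have hLcomp : ∀ ⦃B : C⦄ (φ : B ⟶ A) (hφ : S.IsPullbackMorphism φ) (ε₁ ε₂ : A ⟶ A)
      (h₁ : S.IsBaseIdentity ε₁) (h₂ : S.IsBaseIdentity ε₂) (h₁₂ : S.IsBaseIdentity (ε₁ ≫ ε₂)),
      L φ hφ (ε₁ ≫ ε₂) h₁₂ = L φ hφ ε₁ h₁ ≫ L φ hφ ε₂ h₂ := by
    intro B φ hφ ε₁ ε₂ h₁ h₂ h₁₂
    symm
    apply huniq
    · rw [Category.assoc, (hL φ hφ ε₂ h₂).1, ← Category.assoc, (hL φ hφ ε₁ h₁).1, Category.assoc]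
    · rw [Functor.map_comp, (hL φ hφ ε₁ h₁).2, (hL φ hφ ε₂ h₂).2, Category.comp_id]
  -- … hence compatible with powers (in `End`, `f ^ (n+1) = f ^ n * f = f ≫ f ^ n`)
  have hbase_pow : ∀ (ε : End A), S.IsBaseIdentity ε → ∀ n : ℕ, S.IsBaseIdentity (ε ^ n) := by
    intro ε hε n
    induction n with
    | zero => exact S.base.map_id A
    | succ n ih =>
      show S.base.map (ε ^ (n + 1)) = 𝟙 _
      rw [pow_succ, End.mul_def, Functor.map_comp, ih]
      erw [hε]
      exact Category.comp_id _
  have hLpow : ∀ ⦃B : C⦄ (φ : B ⟶ A) (hφ : S.IsPullbackMorphism φ) (ε : End A)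
      (hε : S.IsBaseIdentity ε) (n : ℕ),
      (show End B from L φ hφ ε hε) ^ n = L φ hφ (ε ^ n) (hbase_pow ε hε n) := by
    intro B φ hφ ε hε n
    induction n with
    | zero =>
      apply huniq
      · show 𝟙 B ≫ φ = φ ≫ 𝟙 A
        rw [Category.id_comp, Category.comp_id]
      · exact S.base.map_id B
    | succ n ih =>
      have e : (ε ^ (n + 1) : End A) = (show A ⟶ A from ε) ≫ (show A ⟶ A from ε ^ n) := by
        rw [pow_succ, End.mul_def]
      rw [pow_succ, End.mul_def, ih]
      apply huniq
      · show (L φ hφ ε hε ≫ L φ hφ (ε ^ n) (hbase_pow ε hε n)) ≫ φ = φ ≫ (show A ⟶ A from ε ^ (n + 1))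
        rw [Category.assoc, (hL φ hφ _ (hbase_pow ε hε n)).1, ← Category.assoc, (hL φ hφ ε hε).1,
          Category.assoc, e]
      · show S.base.map (L φ hφ ε hε ≫ L φ hφ (ε ^ n) (hbase_pow ε hε n)) = 𝟙 _
        rw [Functor.map_comp, (hL φ hφ ε hε).2, (hL φ hφ _ (hbase_pow ε hε n)).2, Category.comp_id]
  -- the data: `Γ` = lifts of `α`, `Δ_d` = lifts of `ζ_d`
  have hαb : S.IsBaseIdentity α := hα.1
  let mk : ∀ (ε : End A), S.IsBaseIdentity ε → S.EndPlbkBsIso A := fun ε hε =>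
    { app := fun B φ hφ => L φ hφ ε hε
      naturality := by
        intro B B' φ hφ φ' hφ' g hg
        -- both sides lie over `ε` along `φ` with base `Base(g)`
        have hcond : S.base.map g ≫ S.base.map φ = S.base.map (g ≫ φ ≫ ε) := by
          rw [Functor.map_comp, Functor.map_comp, hε, Category.comp_id]
        refine (hφ (g ≫ φ ≫ ε) (S.base.map g) hcond).unique ⟨?_, ?_⟩ ⟨?_, ?_⟩
        · show (g ≫ L φ hφ ε hε) ≫ φ = g ≫ φ ≫ ε
          rw [Category.assoc, (hL φ hφ ε hε).1]
        · show S.base.map (g ≫ L φ hφ ε hε) = S.base.map g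
          rw [Functor.map_comp, (hL φ hφ ε hε).2, Category.comp_id]
        · show (L φ' hφ' ε hε ≫ g) ≫ φ = g ≫ φ ≫ ε
          rw [Category.assoc, hg, (hL φ' hφ' ε hε).1, ← Category.assoc, hg]
        · show S.base.map (L φ' hφ' ε hε ≫ g) = S.base.map g
          rw [Functor.map_comp, (hL φ' hφ' ε hε).2, Category.id_comp]
      isBaseIso := by
        intro B φ hφ
        show IsIso (S.base.map (L φ hφ ε hε))
        rw [(hL φ hφ ε hε).2]
        infer_instance }
  refine ⟨mk α hαb, fun d => mk (ζ d) (hζ d).2.1, fun d B φ hφ => ?_, fun B φ hφ => ?_,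
    fun d e B φ hφ => ?_, ?_⟩
  · -- the relation `Δ_d Γ = Γ^d Δ_d`, from `ζ_d α = α^d ζ_d` (Frobenius-normalized) and uniqueness:
    -- both sides are the lift of `ζ_d α`
    have hnorm : α ^ (d : ℕ) * ζ d = ζ d * α := by
      have := hFN.obj A (ζ d) (hζ d).2.1 α hα
      rwa [(hζ d).1] at this
    have hb' : S.IsBaseIdentity (ζ d * α) := by
      show S.base.map ((show A ⟶ A from α) ≫ (show A ⟶ A from ζ d)) = 𝟙 _
      rw [Functor.map_comp, hαb, (hζ d).2.1, Category.comp_id]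
    have lhs : (show End B from L φ hφ (ζ d) (hζ d).2.1) * (show End B from L φ hφ α hαb) =
        L φ hφ (ζ d * α) hb' := by
      apply huniq
      · show (L φ hφ α hαb ≫ L φ hφ (ζ d) (hζ d).2.1) ≫ φ =
          φ ≫ (show A ⟶ A from α) ≫ (show A ⟶ A from ζ d)
        rw [Category.assoc, (hL φ hφ (ζ d) (hζ d).2.1).1, ← Category.assoc, (hL φ hφ α hαb).1,
          Category.assoc]
      · show S.base.map (L φ hφ α hαb ≫ L φ hφ (ζ d) (hζ d).2.1) = 𝟙 _
        rw [Functor.map_comp, (hL φ hφ α hαb).2, (hL φ hφ (ζ d) (hζ d).2.1).2, Category.comp_id]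
    have rhs : (show End B from L φ hφ α hαb) ^ (d : ℕ) * (show End B from L φ hφ (ζ d) (hζ d).2.1) =
        L φ hφ (ζ d * α) hb' := by
      rw [hLpow φ hφ α hαb]
      have e : (show A ⟶ A from ζ d) ≫ (show A ⟶ A from α ^ (d : ℕ)) =
          (show A ⟶ A from α) ≫ (show A ⟶ A from ζ d) := by
        rw [← End.mul_def, ← End.mul_def]; exact hnorm
      apply huniq
      · show (L φ hφ (ζ d) (hζ d).2.1 ≫ L φ hφ (α ^ (d : ℕ)) (hbase_pow α hαb d)) ≫ φ =
          φ ≫ (show A ⟶ A from α) ≫ (show A ⟶ A from ζ d)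
        rw [Category.assoc, (hL φ hφ _ (hbase_pow α hαb d)).1, ← Category.assoc,
          (hL φ hφ (ζ d) (hζ d).2.1).1, Category.assoc, e]
      · show S.base.map (L φ hφ (ζ d) (hζ d).2.1 ≫ L φ hφ (α ^ (d : ℕ)) (hbase_pow α hαb d)) = 𝟙 _
        rw [Functor.map_comp, (hL φ hφ (ζ d) (hζ d).2.1).2, (hL φ hφ _ (hbase_pow α hαb d)).2,
          Category.comp_id]
    exact lhs.trans rhs.symm
  · -- `Δ_1 = 1`: the lift of `ζ_1 = id`
    show L φ hφ (ζ 1) (hζ 1).2.1 = 𝟙 B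
    symm
    apply huniq
    · rw [map_one, Category.id_comp]; exact (Category.comp_id φ).symm
    · exact S.base.map_id B
  · -- `Δ_{de} = Δ_d Δ_e`: lifts are multiplicative
    show L φ hφ (ζ (d * e)) (hζ (d * e)).2.1 = L φ hφ (ζ e) (hζ e).2.1 ≫ L φ hφ (ζ d) (hζ d).2.1
    symm
    apply huniq
    · rw [Category.assoc, (hL φ hφ (ζ d) (hζ d).2.1).1, ← Category.assoc, (hL φ hφ (ζ e) (hζ e).2.1).1,
        Category.assoc, map_mul]
      rfl
    · rw [Functor.map_comp, (hL φ hφ (ζ e) (hζ e).2.1).2, (hL φ hφ (ζ d) (hζ d).2.1).2, Category.comp_id]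
  · -- the component at `id_A` is `α` itself
    symm
    apply huniq
    · rw [Category.comp_id, Category.id_comp]
    · exact hαb

end PreFrobenioidData

end Literature.AlgebraicGeometry.Frobenioids
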